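import Summits.AtomisticToContinuum.Crystallization.Theorems.SquareWellLayerCakeGapTwelveToBarlowCombinatorialLayeringTransportSteps7
import Summits.AtomisticToContinuum.Crystallization.Theorems.SquareWellLayerCakeGapTwelveToBarlowCombinatorialLayeringTransportVinv
import Summits.AtomisticToContinuum.Crystallization.Theorems.SquareWellLayerCakeGapTwelveToBarlowCombinatorialLayeringTransportComm3
import Summits.AtomisticToContinuum.Crystallization.Theorems.SquareWellLayerCakeGapTwelveToBarlowCombinatorialLayeringTransportVComm3
import Summits.AtomisticToContinuum.Crystallization.Theorems.SquareWellLayerCakeGapTwelveToBarlowCombinatorialLayeringTransportGlobalA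

/-!
# Combinatorial layering (B1a of `GapTwelveToBarlow`): one layer up / down of a finite coherent plane

Crux `SquareWellLayerCake.GapTwelveToBarlow` (stmt-AtomisticToContinuum-15807), line `Sketch`,
stub `stub_combinatorialLayering`, residual `(H_develop)`; third piece of the FINITE DEVELOPMENT:
the graded analogues of 9227's `layer_up` / `layer_down` (`…TransportGlobalA`).  For a family
`Φ : ℤ² → frames` valid, levelled (`(Φ i j).pt ∈ S (L i j + 4)`) and coherent on the diamond
`|j| + |i| ≤ R`, the `V`-images (resp. `V⁻¹`-images) of the frames with `|j| + |i| + 3 ≤ R` are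
valid, at level `L i j + 3`, coherent (`V (Φ (i+1) j) = I (V (Φ i j))`, `V (Φ i (j+1)) = J (V (Φ i j))`
whenever both sides are in that range), and the letter read below the new frame is the parity of
the old one (resp. the parity of the new frame is the letter read below the old one).  Inputs:
`nbhdFin` (`…TransportGlobalA`), `Vstep_spec` / `VinvStep_spec` (three levels) and the `V/I`,
`V/J`, `V⁻¹/I`, `V⁻¹/J` commutations (four levels) of the landed port.  All `[folklore]`.
-/

noncomputable section

namespace Summit.AtomisticToContinuum.Crystallization.Theorems.SquareWellLayerCakeGapTwelveToBarlow

open Literature.Geometry.DiscreteGeometry Literature.MathematicalPhysics.StatisticalMechanics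
open Summit.AtomisticToContinuum.Crystallization.Theorems.PalmUnimodularRigidityShellsToBarlowChart hiding
  IsZChart TransportSystem scales_tied sqNormInt_transfer bond_symm nb_mem zlab_spec zlab_nb
  bond_nb_iff pattern_cases transfer_nb_nb transfer_nb_centre transfer_nb_target
  sqNormInt_zlab_centre hcp_of_mirror_pair Istep_spec Jstep_spec IinvStep_spec JinvStep_spec
  capWithAny_of_mem_cap IinvStep_Istep Istep_IinvStep JinvStep_Jstep Jstep_JinvStep polar_at_apex
  onesided_at_apex Vstep_spec nb_inj Istep_lower Jstep_lower IinvStep_lower JinvStep_lower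
  polar_at_lower_apex onesided_at_lower_apex VinvStep_spec attach_I_even attach_I_odd
  attach_lower_I_pos attach_lower_I_neg attach_J_even attach_J_odd Vstep_Istep_pt Vstep_Istep_back
  Vstep_Istep_side Vstep_Jstep_pt Vstep_Istep_comm Vstep_Jstep_comm attach_lower_J_pos
  attach_lower_J_neg VinvStep_Istep_pt VinvStep_Jstep_pt VinvStep_Istep_back VinvStep_Istep_side
  VinvStep_Istep_comm VinvStep_Jstep_comm Istep_Jstep_comm

variable {S : ℕ → Set (EuclideanSpace ℝ (Fin 3))}
  {B : EuclideanSpace ℝ (Fin 3) → EuclideanSpace ℝ (Fin 3) → Prop}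
  {Pc : EuclideanSpace ℝ (Fin 3) → Finset (Fin 3 → ℤ)}
  {nb : EuclideanSpace ℝ (Fin 3) → (Fin 3 → ℤ) → EuclideanSpace ℝ (Fin 3)}

variable
  (hch : (∀ n : ℕ, ∀ z ∈ S n, (Pc z = fcc3Int ∨ Pc z = hcpInt) ∧
      Set.BijOn (nb z) (↑(Pc z) : Set (Fin 3 → ℤ)) {y | B z y} ∧
      ∀ t ∈ Pc z, ∀ t' ∈ Pc z, (B (nb z t) (nb z t') ↔ sqNormInt (t - t') = 18)) ∧
    (∀ n : ℕ, ∀ z ∈ S (n + 1), ∀ y, B z y → y ∈ S n) ∧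
    (∀ n m : ℕ, ∀ x ∈ S n, ∀ y ∈ S m, B x y →
      ∀ (z z' : EuclideanSpace ℝ (Fin 3)) (t t' u u' : Fin 3 → ℤ),
        (t = 0 ∧ z = x ∨ t ∈ Pc x ∧ z = nb x t) → (t' = 0 ∧ z' = x ∨ t' ∈ Pc x ∧ z' = nb x t') →
        (u = 0 ∧ z = y ∨ u ∈ Pc y ∧ z = nb y u) → (u' = 0 ∧ z' = y ∨ u' ∈ Pc y ∧ z' = nb y u') →
        sqNormInt (u - u') = sqNormInt (t - t')) ∧
    (∀ x y, B x y → B y x))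

include hch


/-- **One layer up** (graded `layer_up`): the `V`-images of a finite levelled coherent plane are valid, one level lower, coherent, and the letter read below them is the parity of the plane. [folklore] -/
theorem layerUpFin {R : ℕ} {L : ℤ → ℤ → ℕ} {Φ : ℤ → ℤ → ZFrame}
    (hval : ∀ i j : ℤ, j.natAbs + i.natAbs ≤ R → IsFrame (Pc (Φ i j).pt) (Φ i j).t₁ (Φ i j).t₂ (Φ i j).U)
    (hS : ∀ i j : ℤ, j.natAbs + i.natAbs ≤ R → (Φ i j).pt ∈ S (L i j + 4))
    (hI : ∀ i j : ℤ, j.natAbs + i.natAbs + 1 ≤ R → Φ (i + 1) j = Istep Pc nb (Φ i j))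
    (hJ : ∀ i j : ℤ, j.natAbs + 1 + i.natAbs ≤ R → Φ i (j + 1) = Jstep Pc nb (Φ i j)) :
    (∀ i j : ℤ, j.natAbs + i.natAbs + 3 ≤ R → IsFrame (Pc (Vstep Pc nb (Φ i j)).pt) (Vstep Pc nb (Φ i j)).t₁ (Vstep Pc nb (Φ i j)).t₂ (Vstep Pc nb (Φ i j)).U) ∧
    (∀ i j : ℤ, j.natAbs + i.natAbs + 3 ≤ R → (Vstep Pc nb (Φ i j)).pt ∈ S (L i j + 3)) ∧
    (∀ i j : ℤ, j.natAbs + i.natAbs + 3 ≤ R → j.natAbs + (i + 1).natAbs + 3 ≤ R →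
      Vstep Pc nb (Φ (i + 1) j) = Istep Pc nb (Vstep Pc nb (Φ i j))) ∧
    (∀ i j : ℤ, j.natAbs + i.natAbs + 3 ≤ R → (j + 1).natAbs + i.natAbs + 3 ≤ R →
      Vstep Pc nb (Φ i (j + 1)) = Jstep Pc nb (Vstep Pc nb (Φ i j))) ∧
    (∀ i j : ℤ, j.natAbs + i.natAbs + 3 ≤ R →
      lowerParity (Vstep Pc nb (Φ i j)).t₁ (Vstep Pc nb (Φ i j)).t₂ (lowerCap (Pc (Vstep Pc nb (Φ i j)).pt) (Vstep Pc nb (Φ i j)).t₁ (Vstep Pc nb (Φ i j)).t₂ (Vstep Pc nb (Φ i j)).U) = frameParity (Φ i j).t₁ (Φ i j).t₂ (Φ i j).U) := by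
  have key : ∀ i j : ℤ, j.natAbs + i.natAbs + 3 ≤ R → ∀ (x : EuclideanSpace ℝ (Fin 3)) (t₁ t₂ : Fin 3 → ℤ)
      (U : Finset (Fin 3 → ℤ)), Φ i j = ⟨x, t₁, t₂, U⟩ →
      x ∈ S (L i j + 3 + 1) ∧ IsFrame (Pc x) t₁ t₂ U ∧
      IsFrame (Pc (nb x t₁)) (Istep Pc nb ⟨x, t₁, t₂, U⟩).t₁ (Istep Pc nb ⟨x, t₁, t₂, U⟩).t₂
        (Istep Pc nb ⟨x, t₁, t₂, U⟩).U ∧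
      IsFrame (Pc (nb x t₂)) (Jstep Pc nb ⟨x, t₁, t₂, U⟩).t₁ (Jstep Pc nb ⟨x, t₁, t₂, U⟩).t₂
        (Jstep Pc nb ⟨x, t₁, t₂, U⟩).U ∧
      IsFrame (Pc (nb x (-t₁))) (IinvStep Pc nb ⟨x, t₁, t₂, U⟩).t₁
        (IinvStep Pc nb ⟨x, t₁, t₂, U⟩).t₂ (IinvStep Pc nb ⟨x, t₁, t₂, U⟩).U ∧
      IsFrame (Pc (nb x (-t₂))) (JinvStep Pc nb ⟨x, t₁, t₂, U⟩).t₁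
        (JinvStep Pc nb ⟨x, t₁, t₂, U⟩).t₂ (JinvStep Pc nb ⟨x, t₁, t₂, U⟩).U ∧
      IsFrame (Pc (nb (nb x t₁) (Istep Pc nb ⟨x, t₁, t₂, U⟩).t₁))
        (Istep Pc nb (Istep Pc nb ⟨x, t₁, t₂, U⟩)).t₁ (Istep Pc nb (Istep Pc nb ⟨x, t₁, t₂, U⟩)).t₂
        (Istep Pc nb (Istep Pc nb ⟨x, t₁, t₂, U⟩)).U ∧
      IsFrame (Pc (nb (nb x t₁) (Istep Pc nb ⟨x, t₁, t₂, U⟩).t₂))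
        (Jstep Pc nb (Istep Pc nb ⟨x, t₁, t₂, U⟩)).t₁ (Jstep Pc nb (Istep Pc nb ⟨x, t₁, t₂, U⟩)).t₂
        (Jstep Pc nb (Istep Pc nb ⟨x, t₁, t₂, U⟩)).U ∧
      IsFrame (Pc (nb (nb x t₁) (-(Istep Pc nb ⟨x, t₁, t₂, U⟩).t₁)))
        (IinvStep Pc nb (Istep Pc nb ⟨x, t₁, t₂, U⟩)).t₁ (IinvStep Pc nb (Istep Pc nb ⟨x, t₁, t₂, U⟩)).t₂
        (IinvStep Pc nb (Istep Pc nb ⟨x, t₁, t₂, U⟩)).U ∧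
      IsFrame (Pc (nb (nb x t₁) (-(Istep Pc nb ⟨x, t₁, t₂, U⟩).t₂)))
        (JinvStep Pc nb (Istep Pc nb ⟨x, t₁, t₂, U⟩)).t₁ (JinvStep Pc nb (Istep Pc nb ⟨x, t₁, t₂, U⟩)).t₂
        (JinvStep Pc nb (Istep Pc nb ⟨x, t₁, t₂, U⟩)).U ∧
      IsFrame (Pc (nb (nb x t₂) (Jstep Pc nb ⟨x, t₁, t₂, U⟩).t₂))
        (Jstep Pc nb (Jstep Pc nb ⟨x, t₁, t₂, U⟩)).t₁ (Jstep Pc nb (Jstep Pc nb ⟨x, t₁, t₂, U⟩)).t₂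
        (Jstep Pc nb (Jstep Pc nb ⟨x, t₁, t₂, U⟩)).U ∧
      IsFrame (Pc (nb (nb x t₂) (Jstep Pc nb ⟨x, t₁, t₂, U⟩).t₁))
        (Istep Pc nb (Jstep Pc nb ⟨x, t₁, t₂, U⟩)).t₁ (Istep Pc nb (Jstep Pc nb ⟨x, t₁, t₂, U⟩)).t₂
        (Istep Pc nb (Jstep Pc nb ⟨x, t₁, t₂, U⟩)).U ∧
      IsFrame (Pc (nb (nb x t₂) (-(Jstep Pc nb ⟨x, t₁, t₂, U⟩).t₂)))
        (JinvStep Pc nb (Jstep Pc nb ⟨x, t₁, t₂, U⟩)).t₁ (JinvStep Pc nb (Jstep Pc nb ⟨x, t₁, t₂, U⟩)).t₂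
        (JinvStep Pc nb (Jstep Pc nb ⟨x, t₁, t₂, U⟩)).U ∧
      IsFrame (Pc (nb (nb x t₂) (-(Jstep Pc nb ⟨x, t₁, t₂, U⟩).t₁)))
        (IinvStep Pc nb (Jstep Pc nb ⟨x, t₁, t₂, U⟩)).t₁ (IinvStep Pc nb (Jstep Pc nb ⟨x, t₁, t₂, U⟩)).t₂
        (IinvStep Pc nb (Jstep Pc nb ⟨x, t₁, t₂, U⟩)).U ∧
      Istep Pc nb (Jstep Pc nb ⟨x, t₁, t₂, U⟩) = Jstep Pc nb (Istep Pc nb ⟨x, t₁, t₂, U⟩) :=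
    fun i j hij x t₁ t₂ U h =>
      nbhdFin hch (L := fun i j => L i j + 3) hval (fun i j hr => hS i j hr) hI hJ i j hij h
  refine ⟨fun i j hij => ?_, fun i j hij => ?_, fun i j hij hij' => ?_, fun i j hij hij' => ?_,
    fun i j hij => ?_⟩
  all_goals
    rcases h : Φ i j with ⟨x, t₁, t₂, U⟩
    obtain ⟨hx, hU, hIg, hJg, hIig, hJig, hIIg, hJIg, hIiIg, hJiIg, hJJg, hIJg, hJiJg, hIiJg, hcomm⟩ :=
      key i j hij x t₁ t₂ U h
  · exact (Vstep_spec hch hx hU hIg hJg hIig hJig).2.2.2.2.2.1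
  · exact (Vstep_spec hch hx hU hIg hJg hIig hJig).2.1
  · rw [hI i j (by omega), h]
    exact Vstep_Istep_comm hch hx hU hIg hJg hIig hJig hIIg hJIg hIiIg hJiIg hcomm
  · rw [hJ i j (by omega), h]
    exact Vstep_Jstep_comm hch hx hU hIg hJg hIig hJig hJJg hIJg hJiJg hIiJg hcomm
  · exact (Vstep_spec hch hx hU hIg hJg hIig hJig).2.2.2.2.2.2.1

/-- **One layer down** (graded `layer_down`): the `V⁻¹`-images of a finite levelled coherent plane are valid, one level lower, coherent, and their parity is the letter read below the plane. [folklore] -/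
theorem layerDownFin {R : ℕ} {L : ℤ → ℤ → ℕ} {Φ : ℤ → ℤ → ZFrame}
    (hval : ∀ i j : ℤ, j.natAbs + i.natAbs ≤ R → IsFrame (Pc (Φ i j).pt) (Φ i j).t₁ (Φ i j).t₂ (Φ i j).U)
    (hS : ∀ i j : ℤ, j.natAbs + i.natAbs ≤ R → (Φ i j).pt ∈ S (L i j + 4))
    (hI : ∀ i j : ℤ, j.natAbs + i.natAbs + 1 ≤ R → Φ (i + 1) j = Istep Pc nb (Φ i j))
    (hJ : ∀ i j : ℤ, j.natAbs + 1 + i.natAbs ≤ R → Φ i (j + 1) = Jstep Pc nb (Φ i j)) :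
    (∀ i j : ℤ, j.natAbs + i.natAbs + 3 ≤ R → IsFrame (Pc (VinvStep Pc nb (Φ i j)).pt) (VinvStep Pc nb (Φ i j)).t₁ (VinvStep Pc nb (Φ i j)).t₂ (VinvStep Pc nb (Φ i j)).U) ∧
    (∀ i j : ℤ, j.natAbs + i.natAbs + 3 ≤ R → (VinvStep Pc nb (Φ i j)).pt ∈ S (L i j + 3)) ∧
    (∀ i j : ℤ, j.natAbs + i.natAbs + 3 ≤ R → j.natAbs + (i + 1).natAbs + 3 ≤ R →
      VinvStep Pc nb (Φ (i + 1) j) = Istep Pc nb (VinvStep Pc nb (Φ i j))) ∧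
    (∀ i j : ℤ, j.natAbs + i.natAbs + 3 ≤ R → (j + 1).natAbs + i.natAbs + 3 ≤ R →
      VinvStep Pc nb (Φ i (j + 1)) = Jstep Pc nb (VinvStep Pc nb (Φ i j))) ∧
    (∀ i j : ℤ, j.natAbs + i.natAbs + 3 ≤ R →
      frameParity (VinvStep Pc nb (Φ i j)).t₁ (VinvStep Pc nb (Φ i j)).t₂ (VinvStep Pc nb (Φ i j)).U = lowerParity (Φ i j).t₁ (Φ i j).t₂ (lowerCap (Pc (Φ i j).pt) (Φ i j).t₁ (Φ i j).t₂ (Φ i j).U)) := by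
  have key : ∀ i j : ℤ, j.natAbs + i.natAbs + 3 ≤ R → ∀ (x : EuclideanSpace ℝ (Fin 3)) (t₁ t₂ : Fin 3 → ℤ)
      (U : Finset (Fin 3 → ℤ)), Φ i j = ⟨x, t₁, t₂, U⟩ →
      x ∈ S (L i j + 3 + 1) ∧ IsFrame (Pc x) t₁ t₂ U ∧
      IsFrame (Pc (nb x t₁)) (Istep Pc nb ⟨x, t₁, t₂, U⟩).t₁ (Istep Pc nb ⟨x, t₁, t₂, U⟩).t₂
        (Istep Pc nb ⟨x, t₁, t₂, U⟩).U ∧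
      IsFrame (Pc (nb x t₂)) (Jstep Pc nb ⟨x, t₁, t₂, U⟩).t₁ (Jstep Pc nb ⟨x, t₁, t₂, U⟩).t₂
        (Jstep Pc nb ⟨x, t₁, t₂, U⟩).U ∧
      IsFrame (Pc (nb x (-t₁))) (IinvStep Pc nb ⟨x, t₁, t₂, U⟩).t₁
        (IinvStep Pc nb ⟨x, t₁, t₂, U⟩).t₂ (IinvStep Pc nb ⟨x, t₁, t₂, U⟩).U ∧
      IsFrame (Pc (nb x (-t₂))) (JinvStep Pc nb ⟨x, t₁, t₂, U⟩).t₁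
        (JinvStep Pc nb ⟨x, t₁, t₂, U⟩).t₂ (JinvStep Pc nb ⟨x, t₁, t₂, U⟩).U ∧
      IsFrame (Pc (nb (nb x t₁) (Istep Pc nb ⟨x, t₁, t₂, U⟩).t₁))
        (Istep Pc nb (Istep Pc nb ⟨x, t₁, t₂, U⟩)).t₁ (Istep Pc nb (Istep Pc nb ⟨x, t₁, t₂, U⟩)).t₂
        (Istep Pc nb (Istep Pc nb ⟨x, t₁, t₂, U⟩)).U ∧
      IsFrame (Pc (nb (nb x t₁) (Istep Pc nb ⟨x, t₁, t₂, U⟩).t₂))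
        (Jstep Pc nb (Istep Pc nb ⟨x, t₁, t₂, U⟩)).t₁ (Jstep Pc nb (Istep Pc nb ⟨x, t₁, t₂, U⟩)).t₂
        (Jstep Pc nb (Istep Pc nb ⟨x, t₁, t₂, U⟩)).U ∧
      IsFrame (Pc (nb (nb x t₁) (-(Istep Pc nb ⟨x, t₁, t₂, U⟩).t₁)))
        (IinvStep Pc nb (Istep Pc nb ⟨x, t₁, t₂, U⟩)).t₁ (IinvStep Pc nb (Istep Pc nb ⟨x, t₁, t₂, U⟩)).t₂
        (IinvStep Pc nb (Istep Pc nb ⟨x, t₁, t₂, U⟩)).U ∧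
      IsFrame (Pc (nb (nb x t₁) (-(Istep Pc nb ⟨x, t₁, t₂, U⟩).t₂)))
        (JinvStep Pc nb (Istep Pc nb ⟨x, t₁, t₂, U⟩)).t₁ (JinvStep Pc nb (Istep Pc nb ⟨x, t₁, t₂, U⟩)).t₂
        (JinvStep Pc nb (Istep Pc nb ⟨x, t₁, t₂, U⟩)).U ∧
      IsFrame (Pc (nb (nb x t₂) (Jstep Pc nb ⟨x, t₁, t₂, U⟩).t₂))
        (Jstep Pc nb (Jstep Pc nb ⟨x, t₁, t₂, U⟩)).t₁ (Jstep Pc nb (Jstep Pc nb ⟨x, t₁, t₂, U⟩)).t₂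
        (Jstep Pc nb (Jstep Pc nb ⟨x, t₁, t₂, U⟩)).U ∧
      IsFrame (Pc (nb (nb x t₂) (Jstep Pc nb ⟨x, t₁, t₂, U⟩).t₁))
        (Istep Pc nb (Jstep Pc nb ⟨x, t₁, t₂, U⟩)).t₁ (Istep Pc nb (Jstep Pc nb ⟨x, t₁, t₂, U⟩)).t₂
        (Istep Pc nb (Jstep Pc nb ⟨x, t₁, t₂, U⟩)).U ∧
      IsFrame (Pc (nb (nb x t₂) (-(Jstep Pc nb ⟨x, t₁, t₂, U⟩).t₂)))
        (JinvStep Pc nb (Jstep Pc nb ⟨x, t₁, t₂, U⟩)).t₁ (JinvStep Pc nb (Jstep Pc nb ⟨x, t₁, t₂, U⟩)).t₂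
        (JinvStep Pc nb (Jstep Pc nb ⟨x, t₁, t₂, U⟩)).U ∧
      IsFrame (Pc (nb (nb x t₂) (-(Jstep Pc nb ⟨x, t₁, t₂, U⟩).t₁)))
        (IinvStep Pc nb (Jstep Pc nb ⟨x, t₁, t₂, U⟩)).t₁ (IinvStep Pc nb (Jstep Pc nb ⟨x, t₁, t₂, U⟩)).t₂
        (IinvStep Pc nb (Jstep Pc nb ⟨x, t₁, t₂, U⟩)).U ∧
      Istep Pc nb (Jstep Pc nb ⟨x, t₁, t₂, U⟩) = Jstep Pc nb (Istep Pc nb ⟨x, t₁, t₂, U⟩) :=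
    fun i j hij x t₁ t₂ U h =>
      nbhdFin hch (L := fun i j => L i j + 3) hval (fun i j hr => hS i j hr) hI hJ i j hij h
  refine ⟨fun i j hij => ?_, fun i j hij => ?_, fun i j hij hij' => ?_, fun i j hij hij' => ?_,
    fun i j hij => ?_⟩
  all_goals
    rcases h : Φ i j with ⟨x, t₁, t₂, U⟩
    obtain ⟨hx, hU, hIg, hJg, hIig, hJig, hIIg, hJIg, hIiIg, hJiIg, hJJg, hIJg, hJiJg, hIiJg, hcomm⟩ :=
      key i j hij x t₁ t₂ U h
  · exact (VinvStep_spec hch hx hU hIg hJg hIig hJig).2.2.2.2.2.1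
  · exact (VinvStep_spec hch hx hU hIg hJg hIig hJig).2.1
  · rw [hI i j (by omega), h]
    exact VinvStep_Istep_comm hch hx hU hIg hJg hIig hJig hIIg hJIg hIiIg hJiIg hcomm
  · rw [hJ i j (by omega), h]
    exact VinvStep_Jstep_comm hch hx hU hIg hJg hIig hJig hJJg hIJg hJiJg hIiJg hcomm
  · exact (VinvStep_spec hch hx hU hIg hJg hIig hJig).2.2.2.2.2.2.1


/-- **Level of the next layer** (corollary used as the registered anchor): the `V`-image of a
frame of a finite levelled coherent plane, three inside the boundary, is at level `L i j + 3`.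
[folklore] -/
theorem layerUpFin_mem {R : ℕ} {L : ℤ → ℤ → ℕ} {Φ : ℤ → ℤ → ZFrame}
    (hval : ∀ i j : ℤ, j.natAbs + i.natAbs ≤ R → IsFrame (Pc (Φ i j).pt) (Φ i j).t₁ (Φ i j).t₂ (Φ i j).U)
    (hS : ∀ i j : ℤ, j.natAbs + i.natAbs ≤ R → (Φ i j).pt ∈ S (L i j + 4))
    (hI : ∀ i j : ℤ, j.natAbs + i.natAbs + 1 ≤ R → Φ (i + 1) j = Istep Pc nb (Φ i j))
    (hJ : ∀ i j : ℤ, j.natAbs + 1 + i.natAbs ≤ R → Φ i (j + 1) = Jstep Pc nb (Φ i j))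
    (i j : ℤ) (hij : j.natAbs + i.natAbs + 3 ≤ R) :
    (Vstep Pc nb (Φ i j)).pt ∈ S (L i j + 3) :=
  (layerUpFin hch hval hS hI hJ).2.1 i j hij

/-! ## Registered anchor (closed form) -/

omit hch in
/-- **Closed form of `layerUpFin_mem`** (the registered anchor of this file): the section data
`S, B, Pc, nb` and the standing hypothesis written out (two hypotheses regrouped). [folklore] -/
theorem layerUpFin_mem_graded :
    ∀ {S : ℕ → Set (EuclideanSpace ℝ (Fin 3))} {B : EuclideanSpace ℝ (Fin 3) → EuclideanSpace ℝ
    (Fin 3) → Prop} {Pc : EuclideanSpace ℝ (Fin 3) → Finset (Fin 3 → ℤ)} {nb : EuclideanSpace ℝ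
    (Fin 3) → (Fin 3 → ℤ) → EuclideanSpace ℝ (Fin 3)}, ((∀ n : ℕ, ∀ z ∈ S n, (Pc z =
    Summit.AtomisticToContinuum.Crystallization.Theorems.PalmUnimodularRigidityShellsToBarlowChart.fcc3Int
    ∨ Pc z = Literature.Geometry.DiscreteGeometry.hcpInt) ∧ Set.BijOn (nb z) (↑(Pc z) : Set (Fin
    3 → ℤ)) {y | B z y} ∧ ∀ t ∈ Pc z, ∀ t' ∈ Pc z, (B (nb z t) (nb z t') ↔
    Literature.Geometry.DiscreteGeometry.sqNormInt (t - t') = 18)) ∧ (∀ n : ℕ, ∀ z ∈ S (n + 1),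
    ∀ y, B z y → y ∈ S n) ∧ (∀ n m : ℕ, ∀ x ∈ S n, ∀ y ∈ S m, B x y → ∀ (z z' : EuclideanSpace ℝ
    (Fin 3)) (t t' u u' : Fin 3 → ℤ), (t = 0 ∧ z = x ∨ t ∈ Pc x ∧ z = nb x t) → (t' = 0 ∧ z' = x
    ∨ t' ∈ Pc x ∧ z' = nb x t') → (u = 0 ∧ z = y ∨ u ∈ Pc y ∧ z = nb y u) → (u' = 0 ∧ z' = y ∨
    u' ∈ Pc y ∧ z' = nb y u') → Literature.Geometry.DiscreteGeometry.sqNormInt (u - u') =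
    Literature.Geometry.DiscreteGeometry.sqNormInt (t - t')) ∧ (∀ x y, B x y → B y x)) → ∀ {R :
    ℕ} {L : ℤ → ℤ → ℕ} {Φ : ℤ → ℤ →
    Summit.AtomisticToContinuum.Crystallization.Theorems.PalmUnimodularRigidityShellsToBarlowChart.ZFrame}
    (i j : ℤ), (∀ i j : ℤ, j.natAbs + i.natAbs ≤ R → (Φ i j).pt ∈ S (L i j + 4)) → (∀ i j : ℤ,
    j.natAbs + i.natAbs ≤ R →
    Summit.AtomisticToContinuum.Crystallization.Theorems.PalmUnimodularRigidityShellsToBarlowChart.IsFrame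
    (Pc (Φ i j).pt) (Φ i j).t₁ (Φ i j).t₂ (Φ i j).U) → (∀ i j : ℤ, j.natAbs + i.natAbs + 1 ≤ R →
    Φ (i + 1) j =
    Summit.AtomisticToContinuum.Crystallization.Theorems.PalmUnimodularRigidityShellsToBarlowChart.Istep
    Pc nb (Φ i j)) → (∀ i j : ℤ, j.natAbs + 1 + i.natAbs ≤ R → Φ i (j + 1) =
    Summit.AtomisticToContinuum.Crystallization.Theorems.PalmUnimodularRigidityShellsToBarlowChart.Jstep
    Pc nb (Φ i j)) → j.natAbs + i.natAbs + 3 ≤ R →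
    (Summit.AtomisticToContinuum.Crystallization.Theorems.PalmUnimodularRigidityShellsToBarlowChart.Vstep
    Pc nb (Φ i j)).pt ∈ S (L i j + 3) := by
  intro S B Pc nb hch R L Φ i j hS hval hI hJ hij
  exact layerUpFin_mem hch hval hS hI hJ i j hij

end Summit.AtomisticToContinuum.Crystallization.Theorems.SquareWellLayerCakeGapTwelveToBarlow

end
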